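import Literature.Barriers.CriticalPhenomena.PlaquetteWalkAngleLimitCoefficient
import Literature.Barriers.CriticalPhenomena.PlaquetteWalkContourSum
import Literature.Probability.RandomPlanarGeometry.YangBaxterSAWUnwoundPlaquette
import HarnessLib

/-!
# Barrier catalogue (SAWScalingLimit): the cleared Yang–Baxter vertex functional IS the wound polynomial — the
`Z → ∞` limit coefficient in WOUND form («LIMIT COEFFICIENT — WOUND FORM»)

Continuation of `PlaquetteWalkAngleLimitCoefficient` (the exact top of `P = ybVFPoly Dl a f₀ K`,
`(Z²·weightDen)^K · VF = P(Z)`, `Z = e^{3iθ/8}`). The tree's DEFECT LOCALISATION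
(`YangBaxterSAWUnwoundPlaquette.vertexFunctional_printed_eq_wound_sum`: on `[π/3, 2π/3]`, for any boundary root — outer or
hole — the printed vertex functional at `f₀` is the root phase times the grouped sum over the WOUND class-`B2a` walks at
`f₀`) is read here TERM BY TERM in the square frame and lifted to an identity of polynomials in `Z`:

* `rootPhase_mul_g_eq` — the rhombic term `c(z)·w(γ)e^{−iσ wind_θ(γ)}` of a labelled walk times the root phase
  `e^{−i(5/8)κ(a)}` is the square-frame term `c_{slot z}(θ)·weightL(γ)·t^{q(γ)}` (the contour coefficient of a side is the
  slot coefficient dressed by the side's potential, `crCoef_eq_ybCoeff_mul`);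
* `woundPoly` — the sum over the wound class-`B2a` walks of the polynomial terms of the walk and of its two-arc extension;
  `woundPoly_eval`: on `[π/3, 2π/3]` it evaluates to `(Z²·Den)^K·VF`;
* ★★★ `ybVFPoly_eq_woundPoly` — **`P = woundPoly` as polynomials** (they agree on the image of `[π/3, 2π/3]` under the
  injective `θ ↦ e^{3iθ/8}`): EVERY coefficient of the cleared functional is a sum over the wound groups, at every angle,
  inside or outside the printed range; in particular `ybVFPoly_eq_zero_of_unwoundAt` and
  `vertexFunctional_printed_eq_zero_of_unwoundAt_Ioo` (no wound walk ⇒ the identity holds on ALL of `(0, π)`);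
* ★★ `ybVFPoly_coeff_eq_woundLimitCoeff` — at a level `j` not above the cost of any wound group member
  (`WoundCostGE`), the coefficient of `Z^{4K+1−j}` is the WOUND LIMIT COEFFICIENT `woundLimitCoeff_j`: the sum of the
  leading coefficients of the wound terms of cost exactly `j`, i.e. `lead(Z²·Den)^K` times the partition function of the
  minimal-cost wound walks in the `Z → ∞` limit model of the parent file (straight plaquettes free, doubly visited
  plaquettes unit phases, isolated turns suppressed);
* ★★★ `vertexFunctional_printed_zero_set_finite_of_woundLimitCoeff_ne_zero` /
  `exists_vertexFunctional_printed_ne_zero_of_woundLimitCoeff_ne_zero` — THE WOUND LIMIT CRITERION: a non-zero wound limit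
  coefficient makes the printed vertex functional NOT identically zero in the angle (finitely many zeros in `(0, π)`, at
  most `4K + 1 − j`).

Use (venture lane «pcv-sawmu», FINDING-YB-LIMIT-MODEL): this is the implication «LMNC ⇒ the sufficient half of the
encircling criterion» — the lane's census-grade law LMNC (the wound limit coefficient at the minimal wound cost never
vanishes; 511/511 wound cells on 39 rooted domains, including the mirror-zero and double-hexagonal-zero cells that no
single angle sees) would give «∃ wound class-B2a walk at f₀ ⇒ VF_D(a, f₀; ·) ≢ 0». No claim is made here about LMNC itself.
-/

noncomputable section

open private IsNS from Literature.Probability.RandomPlanarGeometry.YangBaxterSAWGeneralDomain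

namespace Literature.Barriers.CriticalPhenomena.PlaquetteWalk

open Literature.Probability.RandomPlanarGeometry.SAW.YangBaxter
open Real Complex Polynomial

/-! ## Sides as slots; the root phase; the rhombic term of a labelled walk as a square-frame term -/

section Slots

/-- `slotSide f₀ (slotOfSide z) = f₀.side z` (the slot map of `PlaquetteWalkContourSum`). [cite: GlazmanManolescu2019, Lemma 2.1, eq. (CR) (lane plumbing)] -/
theorem slotSide_slotOfSide_eq (f₀ : Face) (z : Side) : slotSide f₀ (slotOfSide z) = f₀.side z := by
  cases z <;> rfl

/-- The root phase `e^{−i(5/8)κ_θ(a)}` relating the catalogue's square-frame functional to the rhombic Lemma-2.1 defect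
(`1` on vertical roots). [cite: GlazmanManolescu2019, §2.1, Lemma 2.1 eq. (CR)] -/
def rootPhase (θ : ℝ) (a : MidEdge) : ℂ := Complex.exp (((-(5 / 8 * slantPot (fun _ => θ) a) : ℝ) : ℂ) * I)

/-- The root phase is a unit, in particular non-zero. [folklore] -/
private theorem rootPhase_ne_zero (θ : ℝ) (a : MidEdge) : rootPhase θ a ≠ 0 := Complex.exp_ne_zero _

/-- **The contour coefficient of a side is the slot coefficient dressed by the side's potential**:
`crCoef θ z = c_{slot z}(θ) · e^{i(5/8)κ_θ(f₀.side z)}`. [cite: GlazmanManolescu2019, Lemma 2.1, eq. (CR)] -/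
theorem crCoef_eq_ybCoeff_mul (θ : ℝ) (f₀ : Face) (z : Side) :
    crCoef θ z = ybCoeff θ (slotOfSide z) * Complex.exp (((5 / 8 * slantPot (fun _ => θ) (f₀.side z) : ℝ) : ℂ) * I) := by
  have c0 : ybCoeff θ 0 = 1 := rfl
  have c1 : ybCoeff θ 1 = ybRatio θ := rfl
  have c2 : ybCoeff θ 2 = -1 := rfl
  have c3 : ybCoeff θ 3 = -ybRatio θ := rfl
  cases z <;> simp only [crCoef, slotOfSide, c0, c1, c2, c3, slantPot_side, Side.slantInd, mul_zero, mul_one]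
  · simp
  · simp
  · rw [ybRatio, neg_mul, ← Complex.exp_add]; congr 2; push_cast; ring
  · rw [ybRatio, ← Complex.exp_add]; congr 1; push_cast; ring

variable {D : Set Face} {a : MidEdge} {r : Face}

/-- ★ **The rhombic term of a labelled walk, times the root phase, is its square-frame term**:
`e^{−i(5/8)κ(a)} · c(z)·w(γ)e^{−iσ·wind_θ(γ)} = c_{slot z}(θ) · weightL(γ) · t^{q(γ)}`.
[cite: GlazmanManolescu2019, §2.1, eq. (2.1) and Lemma 2.1, eq. (CR)] -/
theorem rootPhase_mul_g_eq (θ : ℝ) (ω : ΩG D a r) :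
    rootPhase θ a * ω.g (fun _ => θ) =
      ybCoeff θ (slotOfSide ω.1) * (weightL (printedWeights θ) ω.2.mids * tFiveEighths ^ quarterTurnsL ω.2.mids) := by
  rw [ΩG.g, weightL_mul_zpow_eq_sqParaWeight, YBWalk.sqParaWeight_eq, crCoef_eq_ybCoeff_mul θ r ω.1, rootPhase]
  have e : Complex.exp (((5 / 8 * (slantPot (fun _ => θ) (r.side ω.1) - slantPot (fun _ => θ) a) : ℝ) : ℂ) * I) =
      Complex.exp (((-(5 / 8 * slantPot (fun _ => θ) a)) : ℝ) * I) *
        Complex.exp (((5 / 8 * slantPot (fun _ => θ) (r.side ω.1) : ℝ) : ℂ) * I) := by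
    rw [← Complex.exp_add]; congr 1; push_cast; ring
  rw [e]; ring

end Slots

/-! ## Evaluation of the walk terms -/

section Eval

/-- **A walk term evaluated on the curve**: `termPoly_s(l)(Z(θ)) = (Z²·Den)^K · c_s(θ) · weightL(l) · t^q` within the budget.
[cite: GlazmanManolescu2019, Lemma 2.1 and eq. (1)] -/
theorem termPoly_eval (s : Fin 4) {l : List MidEdge} {K : ℕ} (h : totalExp l ≤ K) {θ : ℝ} (hθ : weightDen θ ≠ 0) :
    (termPoly s l K).eval (Zθ θ) = (Zθ θ ^ 2 * ((weightDen θ : ℝ) : ℂ)) ^ K *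
      (ybCoeff θ s * (weightL (printedWeights θ) l * tFiveEighths ^ quarterTurnsL l)) := by
  unfold termPoly
  simp only [eval_mul, eval_C, eval_pow]
  rw [← weightL_printed_eq_eval l hθ, ← den_eq_eval θ, ybCoeff_eq_eval]
  conv_rhs => rw [← Nat.add_sub_cancel' h, pow_add]
  ring

end Eval

/-! ## The wound polynomial -/

section Wound

variable (Dl : List Face) (a : MidEdge) (f₀ : Face)

/-- The budget bounds every labelled walk at `f₀`. [folklore] -/
private theorem totalExp_le_of_maxExp_le' {K : ℕ} (hK : maxExp Dl a f₀ ≤ K) (ω : ΩG (dom Dl) a f₀) :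
    totalExp ω.2.mids ≤ K := by
  obtain ⟨z, γ⟩ := ω
  have e : f₀.side z = slotSide f₀ (slotOfSide z) := (slotSide_slotOfSide_eq f₀ z).symm
  have h1 : totalExp γ.mids ≤ maxExpTo Dl a (f₀.side z) :=
    Finset.le_sup (f := fun γ : YBWalk (dom Dl) a (f₀.side z) => totalExp γ.mids) (Finset.mem_univ γ)
  have h2 : maxExpTo Dl a (slotSide f₀ (slotOfSide z)) ≤ maxExp Dl a f₀ :=
    Finset.le_sup (f := fun s : Fin 4 => maxExpTo Dl a (slotSide f₀ s)) (Finset.mem_univ (slotOfSide z))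
  rw [← e] at h2
  exact h1.trans (h2.trans hK)

open Classical in
/-- **The polynomial of a wound group member**: the term of a class-`B2a` walk plus the term of its two-arc extension
(class `B2b`) when the first arc in `f₀` is not straight. [cite: GlazmanManolescu2019, Lemma 2.1 (proof: the groups)] -/
def woundTermPoly (hr : RootedFace (dom Dl) a f₀) (K : ℕ) (ω : ΩG (dom Dl) a f₀) : ℂ[X] :=
  termPoly (slotOfSide ω.1) ω.2.mids K +
    if IsNS ω hr then termPoly (slotOfSide (ω.ext₃ hr).1) (ω.ext₃ hr).2.mids K else 0

open Classical in
/-- ★ **THE WOUND POLYNOMIAL**: the sum of the group polynomials over the WOUND class-`B2a` walks at `f₀` (those whose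
excursion polygon, or the companion's, winds around the root). [cite: GlazmanManolescu2019, Lemma 2.1 (proof: the groups)] [cite: Glazman2015WeightedSAW, Lemma 3.1 (proof)] -/
def woundPoly (hr : RootedFace (dom Dl) a f₀) (K : ℕ) : ℂ[X] :=
  ∑ ω ∈ (ΩG.setB2a (dom Dl) a f₀).filter (fun ω => ¬ω.Unwound hr), woundTermPoly Dl a f₀ hr K ω

open Classical in
/-- A wound group polynomial evaluated on the curve is `(Z²·Den)^K` × root phase × the group term `G`.
[cite: GlazmanManolescu2019, Lemma 2.1 (proof: the groups)] -/
theorem woundTermPoly_eval (hr : RootedFace (dom Dl) a f₀) {K : ℕ} (hK : maxExp Dl a f₀ ≤ K) (ω : ΩG (dom Dl) a f₀)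
    {θ : ℝ} (hθ : weightDen θ ≠ 0) :
    (woundTermPoly Dl a f₀ hr K ω).eval (Zθ θ) =
      (Zθ θ ^ 2 * ((weightDen θ : ℝ) : ℂ)) ^ K * (rootPhase θ a * ω.G (fun _ => θ) hr) := by
  unfold woundTermPoly ΩG.G ΩG.T₃
  by_cases hns : IsNS ω hr
  · rw [if_pos hns, if_pos hns, eval_add, termPoly_eval _ (totalExp_le_of_maxExp_le' Dl a f₀ hK ω) hθ,
      termPoly_eval _ (totalExp_le_of_maxExp_le' Dl a f₀ hK (ω.ext₃ hr)) hθ, ← rootPhase_mul_g_eq, ← rootPhase_mul_g_eq]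
    ring
  · rw [if_neg hns, if_neg hns, eval_add, eval_zero, termPoly_eval _ (totalExp_le_of_maxExp_le' Dl a f₀ hK ω) hθ,
      ← rootPhase_mul_g_eq]
    ring

/-- `[π/3, 2π/3] ⊆ (0, π)`. [folklore] -/
private theorem mem_Ioo_of_mem_Icc {θ : ℝ} (hθ : θ ∈ Set.Icc (π / 3) (2 * π / 3)) : θ ∈ Set.Ioo 0 π := by
  constructor <;> nlinarith [hθ.1, hθ.2, Real.pi_pos]

/-- ★★ **THE WOUND POLYNOMIAL EVALUATES TO THE CLEARED VERTEX FUNCTIONAL** on the printed range: for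
`θ ∈ [π/3, 2π/3]`, `woundPoly(Z(θ)) = (Z²·Den)^K · VF_{Dl}(a, f₀; θ)` (the tree's defect localisation
`vertexFunctional_printed_eq_wound_sum`, read term by term in the square frame).
[cite: GlazmanManolescu2019, Lemma 2.1 (statement, "in the form given in [Gl]")] [cite: Glazman2015WeightedSAW, Lemma 3.1 (proof)] -/
theorem woundPoly_eval (hr : RootedFace (dom Dl) a f₀) {K : ℕ} (hK : maxExp Dl a f₀ ≤ K) {θ : ℝ}
    (hθ : θ ∈ Set.Icc (π / 3) (2 * π / 3)) :
    (woundPoly Dl a f₀ hr K).eval (Zθ θ) =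
      (Zθ θ ^ 2 * ((weightDen θ : ℝ) : ℂ)) ^ K * vertexFunctional (printedWeights θ) tFiveEighths (ybCoeff θ) Dl a f₀ := by
  classical
  have hD : weightDen θ ≠ 0 := weightDen_ne_zero_of_mem_Ioo (mem_Ioo_of_mem_Icc hθ)
  rw [vertexFunctional_printed_eq_wound_sum hθ Dl a hr.root f₀ hr.mem, woundPoly, eval_finsetSum, Finset.mul_sum,
    Finset.mul_sum]
  refine Finset.sum_congr rfl fun ω _ => ?_
  rw [woundTermPoly_eval Dl a f₀ hr hK ω hD, rootPhase]

/-- `Z(θ₁) = Z(θ₂)` with both angles in `(0, π)` forces `θ₁ = θ₂`. [folklore] -/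
private theorem eq_of_Zθ_eq' {θ₁ θ₂ : ℝ} (h₁ : θ₁ ∈ Set.Ioo 0 π) (h₂ : θ₂ ∈ Set.Ioo 0 π) (h : Zθ θ₁ = Zθ θ₂) :
    θ₁ = θ₂ := by
  obtain ⟨n, hn⟩ := Complex.exp_eq_exp_iff_exists_int.1 h
  have him := congrArg Complex.im hn
  simp only [Complex.mul_im, Complex.ofReal_re, Complex.ofReal_im, Complex.I_re, Complex.I_im, mul_zero, mul_one,
    add_zero, Complex.add_im, Complex.mul_re, Complex.intCast_re, Complex.intCast_im, zero_mul, sub_zero,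
    Complex.re_ofNat, Complex.im_ofNat] at him
  have hb : |(3 * θ₁ / 8 - 3 * θ₂ / 8 : ℝ)| < 2 * π := by
    rw [abs_lt]; constructor <;> nlinarith [h₁.1, h₁.2, h₂.1, h₂.2, Real.pi_pos]
  have hn0 : (n : ℝ) = 0 := by
    by_contra hne
    have h1 : (1 : ℝ) ≤ |(n : ℝ)| := by
      rw [← Int.cast_abs]; exact_mod_cast Int.one_le_abs (fun e => hne (by simp [e]))
    have h2 : 2 * π ≤ |(3 * θ₁ / 8 - 3 * θ₂ / 8 : ℝ)| := by
      rw [show (3 * θ₁ / 8 - 3 * θ₂ / 8 : ℝ) = n * (2 * π) by linarith, abs_mul, abs_of_pos Real.two_pi_pos]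
      nlinarith [Real.pi_pos, h1]
    linarith
  have e : 3 * θ₁ / 8 = 3 * θ₂ / 8 := by
    have := him; rw [hn0, zero_mul, add_zero] at this; exact this
  linarith

/-- ★★★ **THE CLEARED VERTEX FUNCTIONAL IS THE WOUND POLYNOMIAL**, identically in `Z`: `ybVFPoly Dl a f₀ K = woundPoly`
for every boundary root (outer or hole) and every budget `K ≥ maxExp` — two polynomials agreeing on the image of `[π/3, 2π/3]`
under the injective `θ ↦ e^{3iθ/8}`. Hence EVERY coefficient of the cleared functional is a sum over the wound groups only.
[cite: GlazmanManolescu2019, Lemma 2.1 (statement, "in the form given in [Gl]")] [cite: Glazman2015WeightedSAW, Lemma 3.1 (proof)] -/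
theorem ybVFPoly_eq_woundPoly (hr : RootedFace (dom Dl) a f₀) {K : ℕ} (hK : maxExp Dl a f₀ ≤ K) :
    ybVFPoly Dl a f₀ K = woundPoly Dl a f₀ hr K := by
  apply Polynomial.eq_of_infinite_eval_eq
  have hsub : Zθ '' Set.Icc (π / 3) (2 * π / 3) ⊆ {x | eval x (ybVFPoly Dl a f₀ K) = eval x (woundPoly Dl a f₀ hr K)} := by
    rintro x ⟨θ, hθ, rfl⟩
    rw [Set.mem_setOf_eq, woundPoly_eval Dl a f₀ hr hK hθ,
      ← vertexFunctional_printed_eq_eval Dl a f₀ hK (weightDen_ne_zero_of_mem_Ioo (mem_Ioo_of_mem_Icc hθ))]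
  refine Set.Infinite.mono hsub ((Set.Icc_infinite (by nlinarith [Real.pi_pos])).image ?_)
  exact fun θ₁ h₁ θ₂ h₂ h => eq_of_Zθ_eq' (mem_Ioo_of_mem_Icc h₁) (mem_Ioo_of_mem_Icc h₂) h

end Wound

/-! ## The wound limit coefficient and the criterion in wound form -/

section WoundLimit

variable (Dl : List Face) (a : MidEdge) (f₀ : Face)

open Classical in
/-- **Every wound group member costs at least `j`** (the walk, and its two-arc extension when it exists).
[cite: GlazmanManolescu2019, Lemma 2.1 (proof: the groups)] -/
def WoundCostGE (hr : RootedFace (dom Dl) a f₀) (j : ℕ) : Prop :=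
  ∀ ω ∈ (ΩG.setB2a (dom Dl) a f₀).filter (fun ω => ¬ω.Unwound hr),
    j ≤ cost (slotOfSide ω.1) ω.2.mids ∧ (IsNS ω hr → j ≤ cost (slotOfSide (ω.ext₃ hr).1) (ω.ext₃ hr).2.mids)

open Classical in
/-- ★ **THE WOUND LIMIT COEFFICIENT at level `j`**: the sum, over the wound group members of cost exactly `j`, of the
leading coefficients of their terms — `lead(Z²·Den)^K` times the level-`j` partition function of the WOUND walks in the
`Z → ∞` limit model. [cite: GlazmanManolescu2019, Lemma 2.1 (proof: the groups)] -/
def woundLimitCoeff (hr : RootedFace (dom Dl) a f₀) (K j : ℕ) : ℂ :=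
  ∑ ω ∈ (ΩG.setB2a (dom Dl) a f₀).filter (fun ω => ¬ω.Unwound hr),
    ((if cost (slotOfSide ω.1) ω.2.mids = j then (termPoly (slotOfSide ω.1) ω.2.mids K).leadingCoeff else 0) +
      (if IsNS ω hr ∧ cost (slotOfSide (ω.ext₃ hr).1) (ω.ext₃ hr).2.mids = j then
        (termPoly (slotOfSide (ω.ext₃ hr).1) (ω.ext₃ hr).2.mids K).leadingCoeff else 0))

/-- The coefficient of a term at a level not above its cost: the leading coefficient at its own level, zero above.
[cite: GlazmanManolescu2019, Lemma 2.1 and eq. (1)] -/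
private theorem termPoly_coeff_of_le (s : Fin 4) {l : List MidEdge} {K j : ℕ} (h : totalExp l ≤ K) (hj : j ≤ cost s l) :
    (termPoly s l K).coeff (4 * K + 1 - j) = if cost s l = j then (termPoly s l K).leadingCoeff else 0 := by
  by_cases hc : cost s l = j
  · rw [if_pos hc, ← hc, termPoly_coeff_cost s h]
  · rw [if_neg hc]; exact termPoly_coeff_eq_zero_of_lt_cost s h (by omega)

open Classical in
/-- ★★ **AT A LEVEL NOT ABOVE THE WOUND COSTS THE COEFFICIENT IS THE WOUND LIMIT COEFFICIENT**: if every wound group member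
costs at least `j`, then `coeff_{4K+1−j}(P) = woundLimitCoeff_j`. [cite: GlazmanManolescu2019, Lemma 2.1 (proof: the groups)] -/
theorem ybVFPoly_coeff_eq_woundLimitCoeff (hr : RootedFace (dom Dl) a f₀) {K j : ℕ} (hK : maxExp Dl a f₀ ≤ K)
    (hj : WoundCostGE Dl a f₀ hr j) :
    (ybVFPoly Dl a f₀ K).coeff (4 * K + 1 - j) = woundLimitCoeff Dl a f₀ hr K j := by
  rw [ybVFPoly_eq_woundPoly Dl a f₀ hr hK, woundPoly, finsetSum_coeff, woundLimitCoeff]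
  refine Finset.sum_congr rfl fun ω hω => ?_
  obtain ⟨h1, h2⟩ := hj ω hω
  unfold woundTermPoly
  rw [coeff_add, termPoly_coeff_of_le _ (totalExp_le_of_maxExp_le' Dl a f₀ hK ω) h1]
  congr 1
  by_cases hns : IsNS ω hr
  · rw [if_pos hns, termPoly_coeff_of_le _ (totalExp_le_of_maxExp_le' Dl a f₀ hK _) (h2 hns)]
    by_cases hc : cost (slotOfSide (ω.ext₃ hr).1) (ω.ext₃ hr).2.mids = j
    · rw [if_pos hc, if_pos ⟨hns, hc⟩]
    · rw [if_neg hc, if_neg (fun h => hc h.2)]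
  · rw [if_neg hns, coeff_zero, if_neg (fun h => hns h.1)]

open Classical in
/-- **Degree bound in wound form**: if every wound group member costs at least `j`, `deg P ≤ 4K + 1 − j`.
[cite: GlazmanManolescu2019, Lemma 2.1 (proof: the groups)] -/
theorem natDegree_ybVFPoly_le_of_woundCostGE (hr : RootedFace (dom Dl) a f₀) {K j : ℕ} (hK : maxExp Dl a f₀ ≤ K)
    (hj : WoundCostGE Dl a f₀ hr j) : (ybVFPoly Dl a f₀ K).natDegree ≤ 4 * K + 1 - j := by
  rw [ybVFPoly_eq_woundPoly Dl a f₀ hr hK, woundPoly]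
  refine natDegree_sum_le_of_forall_le _ _ fun ω hω => ?_
  obtain ⟨h1, h2⟩ := hj ω hω
  unfold woundTermPoly
  refine (natDegree_add_le _ _).trans (max_le ?_ ?_)
  · have := natDegree_termPoly_add_cost (slotOfSide ω.1) (K := K) (totalExp_le_of_maxExp_le' Dl a f₀ hK ω); omega
  · by_cases hns : IsNS ω hr
    · rw [if_pos hns]
      have := natDegree_termPoly_add_cost (slotOfSide (ω.ext₃ hr).1) (K := K)
        (totalExp_le_of_maxExp_le' Dl a f₀ hK (ω.ext₃ hr))
      have := h2 hns; omega
    · rw [if_neg hns, natDegree_zero]; exact Nat.zero_le _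

/-- ★★★ **THE WOUND LIMIT CRITERION** («LMNC ⇒ the sufficient half of the encircling criterion»): for a boundary root
(outer or hole), a plaquette `f₀` and a level `j` not above the cost of any wound group member, if the wound limit
coefficient `woundLimitCoeff_j` — the partition function of the minimal wound walks in the `Z → ∞` limit model — is
non-zero, then the printed Yang–Baxter vertex functional at `f₀` is NOT identically zero in the angle: finitely many zeros in
`(0, π)`, at most `4K + 1 − j`. [cite: GlazmanManolescu2019, Lemma 2.1] [cite: Glazman2015WeightedSAW, Lemma 3.1 (proof)] -/
theorem vertexFunctional_printed_zero_set_finite_of_woundLimitCoeff_ne_zero (hr : RootedFace (dom Dl) a f₀) {K j : ℕ}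
    (hK : maxExp Dl a f₀ ≤ K) (hj : WoundCostGE Dl a f₀ hr j) (h : woundLimitCoeff Dl a f₀ hr K j ≠ 0) :
    {θ ∈ Set.Ioo 0 π | vertexFunctional (printedWeights θ) tFiveEighths (ybCoeff θ) Dl a f₀ = 0}.Finite ∧
      {θ ∈ Set.Ioo 0 π | vertexFunctional (printedWeights θ) tFiveEighths (ybCoeff θ) Dl a f₀ = 0}.ncard ≤
        4 * K + 1 - j := by
  have hc : (ybVFPoly Dl a f₀ K).coeff (4 * K + 1 - j) ≠ 0 := by
    rw [ybVFPoly_coeff_eq_woundLimitCoeff Dl a f₀ hr hK hj]; exact h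
  obtain ⟨hfin, hcard⟩ := vertexFunctional_printed_zero_set_finite_of_coeff_ne_zero Dl a f₀ hK hc
  exact ⟨hfin, hcard.trans (natDegree_ybVFPoly_le_of_woundCostGE Dl a f₀ hr hK hj)⟩

/-- ★★ **EXISTENCE FORM**: under the same hypotheses the vertex functional is non-zero at some angle of `(0, π)`.
[cite: GlazmanManolescu2019, Lemma 2.1] [cite: Glazman2015WeightedSAW, Lemma 3.1 (proof)] -/
theorem exists_vertexFunctional_printed_ne_zero_of_woundLimitCoeff_ne_zero (hr : RootedFace (dom Dl) a f₀) {K j : ℕ}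
    (hK : maxExp Dl a f₀ ≤ K) (hj : WoundCostGE Dl a f₀ hr j) (h : woundLimitCoeff Dl a f₀ hr K j ≠ 0) :
    ∃ θ ∈ Set.Ioo 0 π, vertexFunctional (printedWeights θ) tFiveEighths (ybCoeff θ) Dl a f₀ ≠ 0 := by
  obtain ⟨hfin, -⟩ := vertexFunctional_printed_zero_set_finite_of_woundLimitCoeff_ne_zero Dl a f₀ hr hK hj h
  by_contra hall
  push Not at hall
  exact (Set.Ioo_infinite Real.pi_pos)
    (hfin.subset fun θ hθ => ⟨hθ, hall θ hθ⟩)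

/-- ★ **No wound walk ⇒ the cleared functional vanishes identically** (polynomial form of the tree's
`vertexFunctional_printed_eq_zero_of_unwoundAt`, now valid as an identity in `Z`, hence at EVERY angle of `(0, π)`).
[cite: GlazmanManolescu2019, Lemma 2.1] -/
theorem ybVFPoly_eq_zero_of_unwoundAt (hr : RootedFace (dom Dl) a f₀) {K : ℕ} (hK : maxExp Dl a f₀ ≤ K)
    (hU : UnwoundAt (dom Dl) a f₀) : ybVFPoly Dl a f₀ K = 0 := by
  classical
  rw [ybVFPoly_eq_woundPoly Dl a f₀ hr hK, woundPoly]
  refine Finset.sum_eq_zero fun ω hω => ?_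
  rw [Finset.mem_filter] at hω
  exact absurd (ω.unwound_of_unwoundAt hU hr) hω.2

/-- ★ **Hence at an unwound plaquette the identity holds on the WHOLE of `(0, π)`**, not only on the printed range.
[cite: GlazmanManolescu2019, Lemma 2.1] -/
theorem vertexFunctional_printed_eq_zero_of_unwoundAt_Ioo (hr : RootedFace (dom Dl) a f₀) (hU : UnwoundAt (dom Dl) a f₀)
    {θ : ℝ} (hθ : θ ∈ Set.Ioo 0 π) :
    vertexFunctional (printedWeights θ) tFiveEighths (ybCoeff θ) Dl a f₀ = 0 := by
  have key := vertexFunctional_printed_eq_eval Dl a f₀ le_rfl (weightDen_ne_zero_of_mem_Ioo hθ)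
  rw [ybVFPoly_eq_zero_of_unwoundAt Dl a f₀ hr le_rfl hU, eval_zero] at key
  exact (mul_eq_zero.1 key).resolve_left (pow_ne_zero _ (mul_ne_zero (pow_ne_zero _ (Zθ_ne_zero θ))
    (by exact_mod_cast weightDen_ne_zero_of_mem_Ioo hθ)))

end WoundLimit

end Literature.Barriers.CriticalPhenomena.PlaquetteWalk
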